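import Summits.ABC.ABC.Theses.TwistAmplification
import Literature.NumberTheory.EllipticCurves.SzpiroLocalDataProofs
import Literature.NumberTheory.EllipticCurves.SzpiroOfAbcProofs

/-!
# `ModerateWindowCount` (stmt-ABC-1973) — negative-side lemmas VI: the rescaled twist family `sc b k`

Standing-adversary (cdisprove) output (re-certifying, in this namespace, lemmas of the sibling crux file
`Cruxes/SharpModerateLaw/Disproof.lean` §§2.1, 7): `tw b : y² = x³ − b²x + b³` (prime twist of
`y² = x³ − x + 1`, minimal at every place for prime `b ≥ 3`, `b ≠ 23`), its rescalings
`sc b k : y² = x³ − b²k⁴x + b³k⁶` (`= ⟨1/k,0,0,0⟩ • tw b` over `ℚ`, so the SAME conductor by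
`conductorNorm_smul_rat`, but `M⁺ = 110592 b⁶ k¹²`), the conductor bounds `b² ∣ N(tw b) ∣ 368 b²`
(`f_b = 2`, `f₂ ≤ 4`, `f₂₃ ≤ 1`, from `SzpiroLocalDataProofs`), hence `b² ≤ N(sc b k) ≤ 368 b²`, and the
injectivity of `(b, k) ↦ sc b k` on `{b prime} × ℕ₊` (parity of `v_b(b k²)`), and the finiteness engine
`reducedCap_finite` (reduced integral models with capped `M⁺` form a finite set; no minimality needed). Used by the companion file
`NoMinimality` (minimality is load-bearing for the crux). Refuter seat refuter-cdisprove-stmt-ABC-1973-0,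
2026-08-16.
-/

namespace Summit.ABC.ABC.Theorems.ModerateWindowCount.Negative

open Summit.ABC.ABC.Theses.TwistAmplification WeierstrassCurve IsDedekindDomain

noncomputable section

/-! ### 6.1 The family -/

/-- Quadratic twist by `d` of `y² = x³ − x + 1` (conductor `92 = 4·23`; `Δ₀ = −368`). [folklore] -/
def tw (d : ℕ) : WeierstrassCurve ℤ := ⟨0, 0, 0, -((d : ℤ) ^ 2), (d : ℤ) ^ 3⟩

/-- `c₄ (tw d) = 48 d²`. [folklore] -/
theorem tw_c₄ (d : ℕ) : (tw d).c₄ = 48 * (d : ℤ) ^ 2 := by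
  simp only [tw, WeierstrassCurve.c₄, WeierstrassCurve.b₂, WeierstrassCurve.b₄]; ring

/-- `Δ (tw d) = −368 d⁶`. [folklore] -/
theorem tw_Δ (d : ℕ) : (tw d).Δ = -368 * (d : ℤ) ^ 6 := by
  simp only [tw, WeierstrassCurve.Δ, WeierstrassCurve.b₂, WeierstrassCurve.b₄, WeierstrassCurve.b₆,
    WeierstrassCurve.b₈]; ring

/-- `tw d ⊗ ℚ` is elliptic for `d ≠ 0`. [folklore] -/
theorem tw_isElliptic (d : ℕ) [NeZero d] : ((tw d).baseChange ℚ).IsElliptic := by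
  refine ⟨?_⟩
  rw [baseChange_int_Δ, tw_Δ, isUnit_iff_ne_zero]
  have : (d : ℚ) ≠ 0 := by exact_mod_cast NeZero.ne d
  push_cast
  exact mul_ne_zero (by norm_num) (pow_ne_zero _ this)

/-- Minimality of `tw d` at every place for prime `d ≥ 3`, `d ≠ 23` (`v_p(Δ) ≤ 6 < 12`). [folklore] -/
theorem tw_isMinimalAt {d : ℕ} (hd : d.Prime) (h3 : 3 ≤ d) (h23 : d ≠ 23) (v : HeightOneSpectrum ℤ) :
    ((tw d).baseChange ℚ).IsMinimalAt v := by
  apply isMinimalAt_baseChange_int_of_not_pow_dvd_Δ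
  rw [tw_Δ]
  set p := Rat.HeightOneSpectrum.natGenerator v with hp
  have hpp : p.Prime := Rat.HeightOneSpectrum.prime_natGenerator v
  intro hdvd
  have hdvd' : p ^ 12 ∣ 368 * d ^ 6 := by
    have e : -(-368 * (d : ℤ) ^ 6) = ((368 * d ^ 6 : ℕ) : ℤ) := by push_cast; ring
    have : ((p : ℤ) ^ 12) ∣ ((368 * d ^ 6 : ℕ) : ℤ) := by rw [← dvd_neg, e] at hdvd; exact hdvd
    exact_mod_cast this
  by_cases hpd : p = d
  · subst hpd
    have h6 : p ^ 6 ∣ 368 := by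
      have : p ^ 12 = p ^ 6 * p ^ 6 := by ring
      rw [this, mul_comm 368] at hdvd'
      exact (Nat.mul_dvd_mul_iff_left (by positivity)).mp hdvd'
    have : p ^ 6 ≤ 368 := Nat.le_of_dvd (by norm_num) h6
    have h36 : 3 ^ 6 ≤ p ^ 6 := Nat.pow_le_pow_left h3 6
    norm_num at h36
    omega
  · have hcop : Nat.Coprime (p ^ 12) (d ^ 6) :=
      Nat.Coprime.pow _ _ ((Nat.coprime_primes hpp hd).mpr hpd)
    have h368 : p ^ 12 ∣ 368 := hcop.dvd_of_dvd_mul_right hdvd'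
    have hle : p ^ 12 ≤ 368 := Nat.le_of_dvd (by norm_num) h368
    have h2 : 2 ^ 12 ≤ p ^ 12 := Nat.pow_le_pow_left hpp.two_le 12
    norm_num at h2
    omega

/-- Rescaled (non-minimal for `k ≥ 2`) models of `tw b`: `sc b k : y² = x³ − b²k⁴ x + b³k⁶`. [folklore] -/
def sc (b k : ℕ) : WeierstrassCurve ℤ := ⟨0, 0, 0, -((b : ℤ) ^ 2 * (k : ℤ) ^ 4), (b : ℤ) ^ 3 * (k : ℤ) ^ 6⟩

/-- `c₄ (sc b k) = 48 b² k⁴`. [folklore] -/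
theorem sc_c₄ (b k : ℕ) : (sc b k).c₄ = 48 * (b : ℤ) ^ 2 * (k : ℤ) ^ 4 := by
  simp only [sc, WeierstrassCurve.c₄, WeierstrassCurve.b₂, WeierstrassCurve.b₄]; ring

/-- `c₆ (sc b k) = −864 b³ k⁶`. [folklore] -/
theorem sc_c₆ (b k : ℕ) : (sc b k).c₆ = -864 * (b : ℤ) ^ 3 * (k : ℤ) ^ 6 := by
  simp only [sc, WeierstrassCurve.c₆, WeierstrassCurve.b₂, WeierstrassCurve.b₄, WeierstrassCurve.b₆]
  ring

/-- `Δ (sc b k) = −368 b⁶ k¹²`. [folklore] -/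
theorem sc_Δ (b k : ℕ) : (sc b k).Δ = -368 * (b : ℤ) ^ 6 * (k : ℤ) ^ 12 := by
  simp only [sc, WeierstrassCurve.Δ, WeierstrassCurve.b₂, WeierstrassCurve.b₄, WeierstrassCurve.b₆,
    WeierstrassCurve.b₈]
  ring

/-- `M⁺ (sc b k) = 110592 b⁶ k¹²`. [folklore] -/
theorem sc_maxInv (b k : ℕ) :
    max |(sc b k).Δ| (|(sc b k).c₄| ^ 3) = 110592 * (b : ℤ) ^ 6 * (k : ℤ) ^ 12 := by
  rw [sc_Δ, sc_c₄, abs_mul, abs_mul, abs_mul, abs_mul, abs_of_nonpos (by norm_num : (-368 : ℤ) ≤ 0),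
    abs_of_nonneg (by norm_num : (0 : ℤ) ≤ 48), abs_pow, abs_pow, abs_pow, abs_pow, Nat.abs_cast,
    Nat.abs_cast]
  rw [max_eq_right]
  · ring
  · have : (0 : ℤ) ≤ (b : ℤ) ^ 6 * (k : ℤ) ^ 12 := by positivity
    nlinarith

/-- `sc b k ⊗ ℚ` is elliptic for `b, k ≠ 0`. [folklore] -/
theorem sc_isElliptic (b k : ℕ) [NeZero b] [NeZero k] : ((sc b k).baseChange ℚ).IsElliptic := by
  refine ⟨?_⟩
  rw [baseChange_int_Δ, sc_Δ, isUnit_iff_ne_zero]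
  have hb : (b : ℚ) ≠ 0 := by exact_mod_cast NeZero.ne b
  have hk : (k : ℚ) ≠ 0 := by exact_mod_cast NeZero.ne k
  push_cast
  exact mul_ne_zero (mul_ne_zero (by norm_num) (pow_ne_zero _ hb)) (pow_ne_zero _ hk)

/-- `sc b k ⊗ ℚ` is the variable change `u = 1/k` of `tw b ⊗ ℚ`. [folklore] -/
theorem sc_baseChange_eq_smul (b k : ℕ) (hk : (k : ℚ) ≠ 0) :
    (sc b k).baseChange ℚ = (⟨(Units.mk0 (k : ℚ) hk)⁻¹, 0, 0, 0⟩ : VariableChange ℚ) • (tw b).baseChange ℚ := by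
  ext
  · simp [sc, tw, baseChange, variableChange_a₁]
  · simp [sc, tw, baseChange, variableChange_a₂]
  · simp [sc, tw, baseChange, variableChange_a₃]
  · simp [sc, tw, baseChange, variableChange_a₄]; ring
  · simp [sc, tw, baseChange, variableChange_a₆]; ring

/-- Same conductor as `tw b` (the conductor is a `ℚ`-isomorphism invariant). [folklore] -/
theorem sc_conductorNorm (b k : ℕ) [NeZero b] (hk : (k : ℚ) ≠ 0) :
    ((sc b k).baseChange ℚ).conductorNorm ℤ = ((tw b).baseChange ℚ).conductorNorm ℤ := by
  haveI := tw_isElliptic b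
  rw [sc_baseChange_eq_smul b k hk]
  exact conductorNorm_smul_rat _ _

/-- Conductor bounds for the (minimal) base curve `tw b`, `b ≥ 29` prime: `b² ∣ N ∣ 368 b²`
(`f_b = 2`; `f₂ ≤ 4`, `f₂₃ ≤ 1`). [folklore] -/
theorem tw_conductor_bounds {b : ℕ} (hb : b.Prime) (h29 : 29 ≤ b) :
    b ^ 2 ∣ ((tw b).baseChange ℚ).conductorNorm ℤ ∧ ((tw b).baseChange ℚ).conductorNorm ℤ ∣ 368 * b ^ 2 := by
  haveI : NeZero b := ⟨hb.ne_zero⟩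
  haveI := tw_isElliptic b
  have hmin := tw_isMinimalAt hb (by omega) (by omega)
  have hgen : ∀ p : Nat.Primes,
      Rat.HeightOneSpectrum.natGenerator ((Rat.HeightOneSpectrum.primesEquiv (R := ℤ)).symm p) = p :=
    Literature.NumberTheory.EllipticCurves.Rat.natGenerator_primesEquiv_symm
  have hfb : 2 ≤ ((tw b).baseChange ℚ).conductorExponent
      ((Rat.HeightOneSpectrum.primesEquiv (R := ℤ)).symm ⟨b, hb⟩) := by
    apply two_le_conductorExponent_of_dvd_Δ_of_dvd_c₄ (hmin _)
    · rw [hgen ⟨b, hb⟩, tw_Δ]; exact Dvd.intro (-368 * (b : ℤ) ^ 5) (by push_cast; ring)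
    · rw [hgen ⟨b, hb⟩, tw_c₄]; exact Dvd.intro (48 * (b : ℤ)) (by push_cast; ring)
  constructor
  · apply (Nat.Prime.pow_dvd_iff_le_factorization hb (conductorNorm_pos_holds _).ne').mpr
    rw [factorization_conductorNorm_primesEquiv_symm _ ⟨b, hb⟩]
    exact hfb
  · apply conductorNorm_dvd_of_forall_conductorExponent_le _ (by positivity)
    intro p
    set v := (Rat.HeightOneSpectrum.primesEquiv (R := ℤ)).symm p with hv
    have hp : (p : ℕ).Prime := p.2
    have h0 : (368 * b ^ 2) ≠ 0 := by positivity
    by_cases hpb : (p : ℕ) = b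
    · have h5' : 5 ≤ Rat.HeightOneSpectrum.natGenerator v := by rw [hgen p, hpb]; omega
      have hle := (conductorExponent_le_two_of_five_le_natGenerator_holds ((tw b).baseChange ℚ) v) h5'
      refine hle.trans ?_
      apply (Nat.Prime.pow_dvd_iff_le_factorization hp h0).mp
      rw [hpb]; exact Dvd.intro_left 368 rfl
    · by_cases hpΔ : ((Rat.HeightOneSpectrum.natGenerator v : ℕ) : ℤ) ∣ (tw b).Δ
      · have e : -(-368 * (b : ℤ) ^ 6) = ((368 * b ^ 6 : ℕ) : ℤ) := by push_cast; ring
        rw [hgen p, tw_Δ] at hpΔ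
        have hp368 : (p : ℕ) ∣ 368 := by
          have h1 : (p : ℕ) ∣ 368 * b ^ 6 := by
            have : ((p : ℕ) : ℤ) ∣ ((368 * b ^ 6 : ℕ) : ℤ) := by
              rw [← dvd_neg, e] at hpΔ; exact hpΔ
            exact_mod_cast this
          rcases (Nat.Prime.dvd_mul hp).mp h1 with h | h
          · exact h
          · exact absurd ((Nat.prime_dvd_prime_iff_eq hp hb).mp (hp.dvd_of_dvd_pow h)) hpb
        have hp2or23 : (p : ℕ) = 2 ∨ (p : ℕ) = 23 := by
          have : (p : ℕ) ∣ 2 ^ 4 * 23 := by norm_num; exact hp368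
          rcases (Nat.Prime.dvd_mul hp).mp this with h | h
          · exact Or.inl ((Nat.prime_dvd_prime_iff_eq hp Nat.prime_two).mp (hp.dvd_of_dvd_pow h))
          · exact Or.inr ((Nat.prime_dvd_prime_iff_eq hp (by norm_num)).mp h)
        have hbodd2 : ¬ (2 : ℕ) ∣ b := fun h => by
          have := (Nat.prime_dvd_prime_iff_eq Nat.prime_two hb).mp h; omega
        have hb23 : ¬ (23 : ℕ) ∣ b := fun h => by
          have := (Nat.prime_dvd_prime_iff_eq (by norm_num) hb).mp h; omega
        rcases hp2or23 with h2 | h23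
        · have hlt : ((tw b).baseChange ℚ).conductorExponent v < 5 := by
            apply conductorExponent_lt_of_not_pow_dvd (hmin v)
            rw [hgen p, h2, tw_Δ]
            intro hd
            have hd' : 2 ^ 5 ∣ 368 * b ^ 6 := by
              rw [← dvd_neg, e] at hd
              exact_mod_cast hd
            have hcop : Nat.Coprime (2 ^ 5) (b ^ 6) :=
              Nat.Coprime.pow _ _ ((Nat.Prime.coprime_iff_not_dvd Nat.prime_two).mpr hbodd2)
            have := hcop.dvd_of_dvd_mul_right hd'
            norm_num at this
          have : 4 ≤ (368 * b ^ 2).factorization (p : ℕ) := by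
            apply (Nat.Prime.pow_dvd_iff_le_factorization hp h0).mp
            rw [h2]; exact Dvd.intro (23 * b ^ 2) (by ring)
          omega
        · have hlt : ((tw b).baseChange ℚ).conductorExponent v < 2 := by
            apply conductorExponent_lt_of_not_pow_dvd (hmin v)
            rw [hgen p, h23, tw_Δ]
            intro hd
            have hd' : 23 ^ 2 ∣ 368 * b ^ 6 := by
              rw [← dvd_neg, e] at hd
              exact_mod_cast hd
            have hcop : Nat.Coprime (23 ^ 2) (b ^ 6) :=
              Nat.Coprime.pow _ _ ((Nat.Prime.coprime_iff_not_dvd (by norm_num)).mpr hb23)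
            have := hcop.dvd_of_dvd_mul_right hd'
            norm_num at this
          have : 1 ≤ (368 * b ^ 2).factorization (p : ℕ) := by
            apply (Nat.Prime.pow_dvd_iff_le_factorization hp h0).mp
            rw [h23]; exact Dvd.intro (16 * b ^ 2) (by ring)
          omega
      · rw [conductorExponent_eq_zero_of_not_dvd_Δ (hmin v) hpΔ]
        exact Nat.zero_le _

/-- Conductor bounds for `sc b k` (`b ≥ 29` prime, `k ≥ 1`): `b² ≤ N ≤ 368 b²`, as reals. [folklore] -/
theorem sc_conductor_bounds {b k : ℕ} (hb : b.Prime) (h29 : 29 ≤ b) (hk : k ≠ 0) :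
    haveI : NeZero b := ⟨hb.ne_zero⟩; haveI : NeZero k := ⟨hk⟩
    (b : ℝ) ^ 2 ≤ ((((sc b k).baseChange ℚ).conductorNorm ℤ : ℕ) : ℝ) ∧
      ((((sc b k).baseChange ℚ).conductorNorm ℤ : ℕ) : ℝ) ≤ 368 * (b : ℝ) ^ 2 := by
  haveI : NeZero b := ⟨hb.ne_zero⟩
  haveI : NeZero k := ⟨hk⟩
  haveI := tw_isElliptic b
  have hkQ : (k : ℚ) ≠ 0 := by exact_mod_cast hk
  rw [sc_conductorNorm b k hkQ]
  obtain ⟨hlo, hhi⟩ := tw_conductor_bounds hb h29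
  have hN : 0 < ((tw b).baseChange ℚ).conductorNorm ℤ := conductorNorm_pos_holds _
  constructor
  · exact_mod_cast Nat.le_of_dvd hN hlo
  · exact_mod_cast Nat.le_of_dvd (by positivity) hhi

/-- `(b, k) ↦ sc b k` is injective on `{b prime} × ℕ` (read `b k²` off `a₄ = −b²k⁴`, `a₆ = b³k⁶`, then use
that `v_b (b k²)` is odd while `v_b (b' k'²)` is even for a prime `b' ≠ b`). [folklore] -/
theorem sc_injective {b b' k k' : ℕ} (hb : b.Prime) (hb' : b'.Prime) (hk : k ≠ 0) (hk' : k' ≠ 0)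
    (h : sc b k = sc b' k') : b = b' ∧ k = k' := by
  have h4 : (sc b k).a₄ = (sc b' k').a₄ := by rw [h]
  have h6 : (sc b k).a₆ = (sc b' k').a₆ := by rw [h]
  simp only [sc] at h4 h6
  have h4' : b ^ 2 * k ^ 4 = b' ^ 2 * k' ^ 4 := by
    have : (b : ℤ) ^ 2 * (k : ℤ) ^ 4 = (b' : ℤ) ^ 2 * (k' : ℤ) ^ 4 := by linarith
    exact_mod_cast this
  have h6' : b ^ 3 * k ^ 6 = b' ^ 3 * k' ^ 6 := by exact_mod_cast h6
  -- `u = b k²` is determined: `u² = b²k⁴`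
  have hu : b * k ^ 2 = b' * k' ^ 2 := by
    have e1 : (b * k ^ 2) ^ 2 = (b' * k' ^ 2) ^ 2 := by
      calc (b * k ^ 2) ^ 2 = b ^ 2 * k ^ 4 := by ring
        _ = b' ^ 2 * k' ^ 4 := h4'
        _ = (b' * k' ^ 2) ^ 2 := by ring
    exact Nat.pow_left_injective (by norm_num) e1
  -- valuation parity at `b`
  have hbb' : b = b' := by
    by_contra hne
    have hv : (b * k ^ 2).factorization b = (b' * k' ^ 2).factorization b := by rw [hu]
    rw [Nat.factorization_mul hb.ne_zero (pow_ne_zero _ hk), Nat.factorization_mul hb'.ne_zero (pow_ne_zero _ hk'),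
      Nat.factorization_pow, Nat.factorization_pow, hb.factorization, hb'.factorization] at hv
    simp only [Finsupp.coe_add, Pi.add_apply, Finsupp.smul_apply, smul_eq_mul, Finsupp.single_eq_same,
      Finsupp.single_apply] at hv
    split_ifs at hv <;> omega
  subst hbb'
  refine ⟨rfl, ?_⟩
  have : k ^ 2 = k' ^ 2 := Nat.eq_of_mul_eq_mul_left hb.pos hu
  exact Nat.pow_left_injective (by norm_num) this


/-! ### 6.0 Finiteness engine for reduced models with capped `M⁺` (no minimality needed) -/

/-- Reduced models in an `(a₄, a₆)`-box. [folklore] -/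
def box (K L : ℤ) : Set (WeierstrassCurve ℤ) :=
  {W | (W.a₁ = 0 ∨ W.a₁ = 1) ∧ (W.a₃ = 0 ∨ W.a₃ = 1) ∧ (W.a₂ = -1 ∨ W.a₂ = 0 ∨ W.a₂ = 1) ∧
    |W.a₄| ≤ K ∧ |W.a₆| ≤ L}

/-- The `(a₄,a₆)`-box of reduced models is finite. [folklore] -/
theorem box_finite (K L : ℤ) : (box K L).Finite := by
  have hinj : Set.InjOn (fun W : WeierstrassCurve ℤ => (W.a₁, W.a₂, W.a₃, W.a₄, W.a₆)) (box K L) := by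
    intro W _ W' _ h
    simp only [Prod.mk.injEq] at h
    obtain ⟨h1, h2, h3, h4, h6⟩ := h
    ext <;> assumption
  refine Set.Finite.of_finite_image ?_ hinj
  refine Set.Finite.subset (Finset.finite_toSet (Finset.Icc (-1 : ℤ) 1 ×ˢ Finset.Icc (-1 : ℤ) 1 ×ˢ
    Finset.Icc (-1 : ℤ) 1 ×ˢ Finset.Icc (-K) K ×ˢ Finset.Icc (-L) L)) ?_
  rintro _ ⟨W, hW, rfl⟩
  obtain ⟨h₁, h₃, h₂, h₄, h₆⟩ := hW
  simp only [Finset.coe_product, Finset.coe_Icc, Set.mem_prod, Set.mem_Icc]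
  refine ⟨⟨?_, ?_⟩, ⟨?_, ?_⟩, ⟨?_, ?_⟩, abs_le.mp h₄, abs_le.mp h₆⟩ <;> omega

/-- Coefficient bounds for a reduced model from bounds on `c₄` and `c₆`. [folklore] -/
theorem abs_a₄_a₆_le (W : WeierstrassCurve ℤ) (h₁ : W.a₁ = 0 ∨ W.a₁ = 1) (h₃ : W.a₃ = 0 ∨ W.a₃ = 1)
    (h₂ : W.a₂ = -1 ∨ W.a₂ = 0 ∨ W.a₂ = 1) (B : ℤ) (hc₄ : |W.c₄| ≤ B) (hc₆ : |W.c₆| ≤ B) :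
    |W.a₄| ≤ B + 49 ∧ |W.a₆| ≤ 2 * B + 400 := by
  obtain ⟨a₁, a₂, a₃, a₄, a₆⟩ := W
  simp only at h₁ h₂ h₃ hc₄ hc₆ ⊢
  simp only [WeierstrassCurve.c₄, WeierstrassCurve.c₆, WeierstrassCurve.b₂, WeierstrassCurve.b₄,
    WeierstrassCurve.b₆] at hc₄ hc₆
  rw [abs_le] at hc₄ hc₆
  rcases h₁ with rfl | rfl <;> rcases h₃ with rfl | rfl <;> rcases h₂ with rfl | rfl | rfl <;>
    refine ⟨abs_le.mpr ⟨?_, ?_⟩, abs_le.mpr ⟨?_, ?_⟩⟩ <;> nlinarith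

/-- **Finiteness engine.** Reduced integral models with capped `M⁺ = max |Δ| |c₄|³ ≤ B` form a
finite set. [folklore] -/
theorem reducedCap_finite (B : ℤ) :
    {W : WeierstrassCurve ℤ | (W.a₁ = 0 ∨ W.a₁ = 1) ∧ (W.a₃ = 0 ∨ W.a₃ = 1) ∧
      (W.a₂ = -1 ∨ W.a₂ = 0 ∨ W.a₂ = 1) ∧ max |W.Δ| (|W.c₄| ^ 3) ≤ B}.Finite := by
  rcases lt_or_ge B 0 with hB0 | hB0
  · convert Set.finite_empty
    ext W
    simp only [Set.mem_setOf_eq, Set.mem_empty_iff_false, iff_false, not_and]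
    intro _ _ _ h
    have : (0 : ℤ) ≤ max |W.Δ| (|W.c₄| ^ 3) := le_max_of_le_left (abs_nonneg _)
    omega
  refine (box_finite (B ^ 3 + 1728 * B + 49) (2 * (B ^ 3 + 1728 * B) + 400)).subset ?_
  intro W hW
  obtain ⟨h₁, h₃, h₂, hMB⟩ := hW
  have hΔ : |W.Δ| ≤ B := (le_max_left _ _).trans hMB
  have hc₄3 : |W.c₄| ^ 3 ≤ B := (le_max_right _ _).trans hMB
  have hc₄ : |W.c₄| ≤ B := by
    rcases le_or_gt |W.c₄| 1 with h | h
    · rcases (abs_nonneg W.c₄).eq_or_lt with h0 | h0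
      · rw [← h0]; exact hB0
      · calc |W.c₄| ≤ 1 := h
          _ ≤ |W.c₄| ^ 3 := one_le_pow₀ (by omega)
          _ ≤ B := hc₄3
    · calc |W.c₄| ≤ |W.c₄| ^ 3 := le_self_pow₀ h.le (by norm_num)
        _ ≤ B := hc₄3
  have hrel : W.c₆ ^ 2 = W.c₄ ^ 3 - 1728 * W.Δ := by
    have := W.c_relation; linarith
  have habs : |W.c₆| ≤ W.c₆ ^ 2 := by
    rcases le_or_gt 0 W.c₆ with h | h
    · rw [abs_of_nonneg h]; nlinarith
    · rw [abs_of_neg h]; nlinarith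
  have hc₆ : |W.c₆| ≤ B ^ 3 + 1728 * B := by
    calc |W.c₆| ≤ W.c₆ ^ 2 := habs
      _ = W.c₄ ^ 3 - 1728 * W.Δ := hrel
      _ ≤ |W.c₄| ^ 3 + 1728 * |W.Δ| := by
          have h1 : W.c₄ ^ 3 ≤ |W.c₄| ^ 3 := by
            calc W.c₄ ^ 3 ≤ |W.c₄ ^ 3| := le_abs_self _
              _ = |W.c₄| ^ 3 := abs_pow _ _
          have h2 : -(1728 * W.Δ) ≤ 1728 * |W.Δ| := by
            have := neg_abs_le W.Δ; linarith
          linarith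
      _ ≤ B ^ 3 + 1728 * B := by
          have : |W.c₄| ^ 3 ≤ B ^ 3 := pow_le_pow_left₀ (abs_nonneg _) hc₄ 3
          linarith
  have hc₄' : |W.c₄| ≤ B ^ 3 + 1728 * B := by
    have : (0 : ℤ) ≤ B ^ 3 := by positivity
    linarith
  obtain ⟨h4, h6⟩ := abs_a₄_a₆_le W h₁ h₃ h₂ _ hc₄' hc₆
  exact ⟨h₁, h₃, h₂, h4, h6⟩

end

end Summit.ABC.ABC.Theorems.ModerateWindowCount.Negative
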